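import Literature.MathematicalPhysics.QuantumFieldTheory.Balaban1983to89.B10LargeFieldSum
import HarnessLib

/-!
# R3 (cell `ym3-torus`, YM₃ on T³ — a ladder RUNG, NOT d = 4, NOT the Clay problem), UV-stability node (UV3) side of the
# 19936 deep-heights question: **THE MODEL-INDEPENDENT LARGE-FIELD RESUMMATION OF [Balaban1985UV3] (41) / [Balaban1982Higgs2] §3.C
# KEEPS ONE SMALL FACTOR WHEN ONE LARGE-FIELD PLAQUETTE IS PINNED**

Seat `ym3-torus-px13` g11 (width copy of `ym3-torus-p1`, whose original purpose is R3's UV-stability node: CMP 102 Thm 1 typed with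
every gap named — HOME `UV3-NODE.md`).  THEOREMS ONLY (0 `def`, 0 `sorry`); `--supports stmt-QuantumFields-19936 --as helper`;
count-neutral.  Bears on the cell's LINE-31 question «PinnedStability» (px8 g10 mechanism memo «PINNED (41)», LEAD ★w1-19936 g11
socket `UnitScaleTiltHistoryTailOfPinnedHeightTail.historyTailL_of_pinnedHeightTail (hP)`): the socket wants, per height, a bound
`C·β^A·exp(−c·p(g)²)` for the Gibbs mass of «this plaquette is large at that RG step»; the factor `exp(−c·p(g)²)` is what survives
of (70)/(71) p. 273 once the sum over all OTHER large-field histories has been paid.  This file proves exactly that survival at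
the level where the tree holds the (41) history sum — lit ✓`B10LargeFieldSum` (the refined carrier `HistModel T` over
`B10.TowerRun`, its `dominated` inequality, the verbatim leaves `SmallFactorsAll` (67)–(71), `ZtermRate` (41)/(66), `ZvolCover`
(39) + pp. 267–268) — with the SAME hypotheses and provisos as the un-pinned kernel theorem ✓`largeFieldControl_of_resummation`
(whose conclusion is the END theorem's leaf `AnalyticLeaves.lf` via ✓`Balaban3D.Proofs.LargeFieldStd.lf_stdTowerInput`).

THE PRINT.  [Balaban1985UV3] (41) p. 266 (the inductive bound, a sum over large-field histories `{Ω_j, Λ_j, Z_j}` with the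
volume terms `Σ_j O(log g_j⁻¹)|Z_j|`); (67)–(71) p. 273 («We get these small factors for all plaquettes in all large fields set
P»: each large plaquette `p′ ⊂ Λ_j` costs `exp(−¼p(g_j)²)`); pp. 273–274 «The analysis of Sect. 3.C [9], which is model
independent, show that these small factors are enough to control all sums in (41)» ([9] = [Balaban1982Higgs2] §3.C).
The pinned statement is NOT printed; it is the termwise reading of the same two sentences (print never isolates one history).

HOW PINNING IS EXPRESSED on the abstract carrier (`B10.TowerRun.LF k U F` only NAMES the history sum; lit `B10.lean` :404–410):
«only histories `h` whose large-field plaquettes `disc k h` contain the candidate `e₀ = (j, p′)`» is the PENALTY functional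
`LF k U (F − π)` with any penalty `π ≥ 0` that is `≥ M` on the histories NOT through `e₀`; `M → ∞` recovers the restricted sum
(monotone in `M` by `lf_mono`), and every finite `M` already gives the bound below with an additive `e^{−M}`.

WHAT IS PROVED (ns `…Theorems.UV3PinnedLargeFieldResummation`).
* §1 ★ `sum_powerset_exp_sum_penalty_le` — the PINNED resummation identity: for a finite candidate set `E ∋ e₀`, per-candidate
  exponents `θ`, and `M`: `Σ_{Q ⊆ E} exp(Σ_{e∈Q} θ_e − M·𝟙[e₀ ∉ Q]) ≤ (e^{θ_{e₀}} + e^{−M}) · exp(Σ_{e∈E} e^{θ_e})`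
  (split `E.powerset` along `e₀` with `Finset.sum_powerset_insert`; the `Q ∋ e₀` half factors `e^{θ_{e₀}}` out EXACTLY; then
  lit ✓`sum_powerset_exp_sum_le` on `E.erase e₀`).
* §2 ★★★ `largeField_pinned_of_resummation` — under EXACTLY the hypotheses of lit ✓`largeFieldControl_of_resummation` (the three
  leaves, `0 < g_j ≤ g̃ ≤ 1`, the progression `x(g_j) = x_K + (K − j)ℓ`, the provisos `3r₀ + 2 ≤ 2p₀`, `8(A + A₀)(c_gρ)³∕ℓ ≤ c₁b₀²`,
  `8(σ + ℓ) ≤ c₁b₀²ℓ`): for every step `k ≤ K`, configuration `U`, candidate `e₀ ∈ E k`, level `M` and penalty `π ≥ 0` with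
  `π h ≥ M` whenever `e₀ ∉ disc k h`,
  `LF k U (fun h ↦ −mainT k h U + Zterm k h − π h) ≤ (exp(−(c₁∕8)·p(g_{e₀.1})²) + exp(−M)) · exp((3∕ℓ)·|T₁^{(k)}|)`
  — ONE pinned large-field plaquette at scale `e₀.1` leaves the factor `exp(−(c₁∕8)·p(g_{e₀.1})²)` in front of the un-pinned
  bound `exp(d·|T₁^{(k)}|)`, `d = 3∕ℓ`.  The constant is `c₁∕8`, NOT print's `¼`: half of (71)'s `c₁·¼p²` pays the volume terms and
  the scale entropy inside the resummation (lit `perSource_net_le`), `c₁ ∈ (0, 1]` being the overlap constant of the corner regions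
  Δ′(p′) (cell GAPS G-B10-10(a)).  Proof = the lit proof's interior (domination with the penalised bounding function, per-history
  exponent ≤ the sum of surviving per-source factors, `perSource_net_le`, `sum_candidates_le`, `scaleEntropy_sum_le`) with §1 in
  place of `sum_powerset_exp_sum_le` — adapted from lit `B10LargeFieldSum.largeFieldControl_of_resummation`.
* §2 ★★ `largeField_pinned_of_resummation_gRun` — the same on the printed flow `g_j = g(Lʲε)^{1∕2}` (`ℓ = ½ log L`, `σ = 3 log L`,
  second proviso `56 ≤ c₁b₀²`), twin of lit ✓`largeFieldControl_of_resummation_gRun`.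
* §3 ★ `largeField_pinned_scale_mono` — the surviving factor is MONOTONE DOWN THE SCALES: for `i ≤ j ≤ K` on the window,
  `exp(−(c₁∕8)p(g_i)²) ≤ exp(−(c₁∕8)p(g_j)²)` (`g_i ≤ g_j ⇒ p(g_i) ≥ p(g_j)`), so a pin at ANY earlier scale `i ≤ j` near the
  event's plaquette is at least as good as a pin at `j` (the form the dictionary step of «PinnedStability» consumes when the
  event's plaquette lies outside `Λ_j`, inside an earlier collar).

WHAT THIS DOES NOT DO (honest scope).  It does not produce the small factors (67)–(71) (leaf `SmallFactorsAll`, Sect. C–D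
analysis), nor the carrier from the true integrals (`HistModel` only NAMES (41)'s objects), nor the pinned form of the STEP bound
(41) for the indicator-weighted tower `ρ̃_k := T^{k−j}(ρ_j·𝟙_A)` — that is the UV3 node's Sect. C leaf bundle re-instantiated at
one step (LOCATE memo `LOCATE-PINNED41-ON-UV3-NODE-px13g11.md`), nor the dictionary between «`dist1(Ū^j(∂a)) ≥ θ`» and print's
«`|V_j(∂p′) − 1| ≥ g_jp(g_j)`», nor the lower bound (47).  Nothing of `hP`, `HistoryTailL` (19936), K1 (23532), (Q) (23133), UV3's
Tier A∕B∕E inputs, any crux, rung, continuum statement, mass gap or Clay problem is proved here.  d = 3 throughout.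

References: T. Bałaban, *Ultraviolet stability of three-dimensional lattice pure gauge field theories*, Commun. Math. Phys. **102**
(1985) 255–275 [Balaban1985UV3] ((41) p. 266, (67)–(71) p. 273, pp. 273–274, (7) p. 257, (5) p. 256); T. Bałaban, *(Higgs)₂,₃
quantum fields in a finite volume. II. An upper bound*, Commun. Math. Phys. **86** (1982) 555–594 [Balaban1982Higgs2] (§3.C).
-/

set_option autoImplicit false

noncomputable section

namespace Summit.QuantumFields.YangMills.Theorems.UV3PinnedLargeFieldResummation

open Literature.MathematicalPhysics.QuantumFieldTheory.Balaban1983to89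
open Literature.MathematicalPhysics.QuantumFieldTheory.Balaban1983to89.B10LargeField
open Literature.MathematicalPhysics.QuantumFieldTheory.Balaban1983to89.B10LargeFieldSum

/-! ## §1 The pinned resummation identity (abstract) -/

section Resummation

variable {ι : Type*} [DecidableEq ι]

/-- ★ **THE {P_j}-RESUMMATION WITH ONE CANDIDATE PINNED.**  For a finite candidate set `E ∋ e₀`, per-candidate exponents `θ` and a
penalty level `M`: `Σ_{Q ⊆ E} exp(Σ_{e∈Q} θ_e − M·𝟙[e₀ ∉ Q]) ≤ (e^{θ_{e₀}} + e^{−M}) · exp(Σ_{e∈E} e^{θ_e})` — the sub-families through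
`e₀` contribute `e^{θ_{e₀}} · Σ_{Q′ ⊆ E∖e₀} exp(Σ_{Q′} θ)` EXACTLY, the others at most `e^{−M}` times the same; both sums are bounded by
lit ✓`sum_powerset_exp_sum_le`.  This is the counting device of pp. 273–274 «these small factors are enough to control all sums in
(41)» read termwise for the histories through one plaquette. [cite: Balaban1985UV3, (8) p.258, pp.273–274; Balaban1982Higgs2, §3.C] -/
theorem sum_powerset_exp_sum_penalty_le (E : Finset ι) (θ : ι → ℝ) {e₀ : ι} (he₀ : e₀ ∈ E) (M : ℝ) :
    ∑ Q ∈ E.powerset, Real.exp (∑ e ∈ Q, θ e - (if e₀ ∈ Q then 0 else M))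
      ≤ (Real.exp (θ e₀) + Real.exp (-M)) * Real.exp (∑ e ∈ E, Real.exp (θ e)) := by
  set s : Finset ι := E.erase e₀ with hs
  have hEs : E = insert e₀ s := (Finset.insert_erase he₀).symm
  have he₀s : e₀ ∉ s := Finset.notMem_erase e₀ E
  -- split the powerset of `insert e₀ s` along `e₀`
  rw [hEs, Finset.sum_powerset_insert he₀s]
  -- the families avoiding `e₀`
  have h1 : ∑ Q ∈ s.powerset, Real.exp (∑ e ∈ Q, θ e - (if e₀ ∈ Q then 0 else M))
      = Real.exp (-M) * ∑ Q ∈ s.powerset, Real.exp (∑ e ∈ Q, θ e) := by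
    rw [Finset.mul_sum]
    refine Finset.sum_congr rfl fun Q hQ => ?_
    have hQ' : e₀ ∉ Q := fun h => he₀s (Finset.mem_powerset.mp hQ h)
    rw [if_neg hQ', ← Real.exp_add]
    congr 1
    ring
  -- the families through `e₀`
  have h2 : ∑ Q ∈ s.powerset, Real.exp (∑ e ∈ insert e₀ Q, θ e - (if e₀ ∈ insert e₀ Q then 0 else M))
      = Real.exp (θ e₀) * ∑ Q ∈ s.powerset, Real.exp (∑ e ∈ Q, θ e) := by
    rw [Finset.mul_sum]
    refine Finset.sum_congr rfl fun Q hQ => ?_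
    have hQ' : e₀ ∉ Q := fun h => he₀s (Finset.mem_powerset.mp hQ h)
    rw [if_pos (Finset.mem_insert_self e₀ Q), sub_zero, Finset.sum_insert hQ', Real.exp_add]
  rw [h1, h2]
  have hsub : ∑ Q ∈ s.powerset, Real.exp (∑ e ∈ Q, θ e) ≤ Real.exp (∑ e ∈ insert e₀ s, Real.exp (θ e)) := by
    refine (sum_powerset_exp_sum_le s θ).trans (Real.exp_le_exp.mpr ?_)
    rw [Finset.sum_insert he₀s]
    linarith [Real.exp_pos (θ e₀)]
  have hM : 0 ≤ Real.exp (-M) := (Real.exp_pos _).le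
  have hθ : 0 ≤ Real.exp (θ e₀) := (Real.exp_pos _).le
  nlinarith [hsub, hM, hθ]

end Resummation

/-! ## §2 The large-field sum of (41) with one large-field plaquette pinned -/

section Main

variable {T : B10.TowerRun}

/-- ★★★ **ONE PINNED LARGE-FIELD PLAQUETTE LEAVES ITS SMALL FACTOR IN FRONT OF THE (41) RESUMMATION.**  Let a run `T` carry a refined
history model `X` with the three verbatim leaves of lit `B10LargeFieldSum` — small factors for all large-field plaquettes with overlap
constant `c₁ ≥ 0` in the regime `g_j ≤ g̃ ≤ 1` ((67)–(71) p. 273), the rate `A` of the volume terms ((41)/(66)), the counted collar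
cover with constants `c_g, ρ = R₁M₁, r₀` (pp. 267–268, (39)) — and let the couplings follow the progression `x(g_j) = x_K + (K − j)ℓ`;
assume the provisos `3r₀ + 2 ≤ 2p₀`, `8(A + A₀)(c_gρ)³∕ℓ ≤ c₁b₀²`, `8(σ + ℓ) ≤ c₁b₀²ℓ` (EXACTLY the hypotheses of lit
✓`largeFieldControl_of_resummation`).  THEN for every step `k ≤ K`, configuration `U`, candidate `e₀ ∈ E k` (a (scale, plaquette)
pair, scale `e₀.1 < k`), level `M`, and penalty `π ≥ 0` with `M ≤ π h` on every history NOT through `e₀`: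
`LF k U (−mainT + Zterm − π) ≤ (exp(−(c₁∕8)·p(g_{e₀.1})²) + exp(−M)) · exp((3∕ℓ)·|T₁^{(k)}|)`.
The un-pinned bound is `exp((3∕ℓ)|T₁^{(k)}|)` (lit, `d = 3∕ℓ`); the pin keeps `exp(−(c₁∕8)p(g_{e₀.1})²)` — `c₁∕8`, not print's `¼`,
because half of (71)'s factor pays the volume terms and the scale entropy (lit `perSource_net_le`).  Adapted from lit
`B10LargeFieldSum.largeFieldControl_of_resummation` (same interior; §1 replaces `sum_powerset_exp_sum_le`).
[cite: Balaban1985UV3, (41) p.266, (67)–(71) p.273, pp.273–274, (7) p.257, (5) p.256; Balaban1982Higgs2, §3.C] -/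
theorem largeField_pinned_of_resummation (X : HistModel T) {A c₁ gs cg ρ r₀ ℓ xK : ℝ}
    (hSF : SmallFactorsAll X c₁ gs) (hZ : ZtermRate X A) (hV : ZvolCover X cg ρ r₀)
    (hA : 0 ≤ A) (hc₁ : 0 ≤ c₁) (hcg : 0 ≤ cg * ρ) (hr : 0 ≤ r₀) (hℓ : 0 < ℓ)
    (hg : ∀ j, j ≤ T.K → 0 < T.g j ∧ T.g j ≤ gs) (hgs : gs ≤ 1)
    (hx : ∀ j, j ≤ T.K → xlog (T.g j) = xK + ((T.K - j : ℕ) : ℝ) * ℓ)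
    (hp : r₀ * 3 + 2 ≤ 2 * T.p₀)
    (hb₁ : 8 * ((A + X.A₀) * (cg * ρ) ^ 3 / ℓ) ≤ c₁ * T.b₀ ^ 2)
    (hb₂ : 8 * (X.σ + ℓ) ≤ c₁ * T.b₀ ^ 2 * ℓ)
    {k : ℕ} (hk : k ≤ T.K) (U : T.Cfg k) {e₀ : ℕ × X.α} (he₀ : e₀ ∈ X.E k) (M : ℝ)
    (π : T.Hist k → ℝ) (hπ0 : ∀ h, 0 ≤ π h) (hπM : ∀ h, e₀ ∉ X.disc k h → M ≤ π h) :
    T.LF k U (fun h => -(T.mainT k h U) + T.Zterm k h - π h)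
      ≤ (Real.exp (-(c₁ / 8 * B10.pFun T.b₀ T.p₀ (T.g e₀.1) ^ 2)) + Real.exp (-M))
          * Real.exp (3 / ℓ * T.sites k) := by
  classical
  -- the unit x_j = 1 + log g_j⁻¹ along the run
  set x : ℕ → ℝ := fun j => xlog (T.g j) with hxdef
  have hx1 : ∀ j, j ≤ T.K → 1 ≤ x j := fun j hj => one_le_xlog (hg j hj).1 ((hg j hj).2.trans hgs)
  have hxmono : ∀ i j, i ≤ j → j ≤ T.K → x j ≤ x i := by
    intro i j hij hj
    show xlog (T.g j) ≤ xlog (T.g i)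
    rw [hx i (hij.trans hj), hx j hj]
    have : ((T.K - j : ℕ) : ℝ) ≤ ((T.K - i : ℕ) : ℝ) := by exact_mod_cast Nat.sub_le_sub_left hij _
    nlinarith
  have hxdiff : ∀ i, i ≤ k → x i - x k = ((k - i : ℕ) : ℝ) * ℓ := by
    intro i hi
    show xlog (T.g i) - xlog (T.g k) = ((k - i : ℕ) : ℝ) * ℓ
    rw [hx i (hi.trans hk), hx k hk]
    have hcast : ((T.K - i : ℕ) : ℝ) = ((T.K - k : ℕ) : ℝ) + ((k - i : ℕ) : ℝ) := by
      rw [← Nat.cast_add]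
      congr 1
      omega
    rw [hcast]
    ring
  have hp1 : 1 ≤ 2 * T.p₀ := by linarith
  have hκ : 0 ≤ c₁ * T.b₀ ^ 2 / 8 := by positivity
  -- per-source data: collar volume, accumulated rates, gain, surviving exponent
  let V : ℕ × X.α → ℝ := fun e => (cg * ρ) ^ 3 * x e.1 ^ (3 * r₀)
  let S : ℕ × X.α → ℝ := fun e => ∑ j ∈ (Finset.range k).filter (fun j => e.1 ≤ j), (A * x j + X.A₀)
  let gain : ℕ × X.α → ℝ := fun e => c₁ * (T.b₀ * x e.1 ^ T.p₀) ^ 2 / 4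
  let θ : ℕ × X.α → ℝ := fun e => -(c₁ * (T.b₀ * x e.1 ^ T.p₀) ^ 2 / 8)
  -- the PENALISED bounding function of the discrete data
  let B : Finset (ℕ × X.α) → ℝ := fun Q =>
    -(∑ e ∈ Q, gain e) + ∑ j ∈ Finset.range k, A * x j * X.zvol k j Q - (if e₀ ∈ Q then 0 else M)
  have hFB : ∀ h, -(T.mainT k h U) + T.Zterm k h - π h ≤ B (X.disc k h) := by
    intro h
    have h1 := hSF hg k hk U h
    have h2 := hZ k hk h
    have h3 : c₁ * ∑ e ∈ X.disc k h, B10.pFun T.b₀ T.p₀ (T.g e.1) ^ 2 / 4 = ∑ e ∈ X.disc k h, gain e := by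
      rw [Finset.mul_sum]
      refine Finset.sum_congr rfl fun e _ => ?_
      simp only [gain, pFun_eq, hxdef]
      ring
    have h4 : (if e₀ ∈ X.disc k h then (0 : ℝ) else M) ≤ π h := by
      by_cases hm : e₀ ∈ X.disc k h
      · rw [if_pos hm]; exact hπ0 h
      · rw [if_neg hm]; exact hπM h hm
    show -(T.mainT k h U) + T.Zterm k h - π h
        ≤ -(∑ e ∈ X.disc k h, gain e) + ∑ j ∈ Finset.range k, A * x j * X.zvol k j (X.disc k h)
            - (if e₀ ∈ X.disc k h then 0 else M)
    linarith
  have hdom := X.dominated k hk U (fun h => -(T.mainT k h U) + T.Zterm k h - π h) B hFB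
  -- each history's exponent is at most the sum of the surviving (halved) small factors of its plaquettes, minus the penalty
  have hsummand : ∀ Q ∈ (X.E k).powerset,
      Real.exp (B Q + X.A₀ * ∑ j ∈ Finset.range k, X.zvol k j Q)
        ≤ Real.exp (∑ e ∈ Q, θ e - (if e₀ ∈ Q then 0 else M)) := by
    intro Q hQ
    rw [Finset.mem_powerset] at hQ
    apply Real.exp_le_exp.mpr
    have hz : ∀ j ∈ Finset.range k, (A * x j + X.A₀) * X.zvol k j Q
        ≤ (A * x j + X.A₀) * ∑ e ∈ Q.filter (fun e => e.1 ≤ j), V e := by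
      intro j hj
      rw [Finset.mem_range] at hj
      have hxj : 1 ≤ x j := hx1 j (by omega)
      have hrate : 0 ≤ A * x j + X.A₀ := by nlinarith [X.A₀_nonneg]
      exact mul_le_mul_of_nonneg_left (hV k hk Q hQ j hj) hrate
    have step1 : B Q + X.A₀ * ∑ j ∈ Finset.range k, X.zvol k j Q
        = -(∑ e ∈ Q, gain e) + ∑ j ∈ Finset.range k, (A * x j + X.A₀) * X.zvol k j Q
            - (if e₀ ∈ Q then 0 else M) := by
      show (-(∑ e ∈ Q, gain e) + ∑ j ∈ Finset.range k, A * x j * X.zvol k j Q - (if e₀ ∈ Q then 0 else M))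
          + X.A₀ * ∑ j ∈ Finset.range k, X.zvol k j Q
          = -(∑ e ∈ Q, gain e) + ∑ j ∈ Finset.range k, (A * x j + X.A₀) * X.zvol k j Q
              - (if e₀ ∈ Q then 0 else M)
      have e1 : ∑ j ∈ Finset.range k, (A * x j + X.A₀) * X.zvol k j Q
          = ∑ j ∈ Finset.range k, A * x j * X.zvol k j Q + X.A₀ * ∑ j ∈ Finset.range k, X.zvol k j Q := by
        rw [Finset.mul_sum, ← Finset.sum_add_distrib]
        refine Finset.sum_congr rfl fun j _ => ?_
        ring
      rw [e1]
      ring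
    have step2 : ∑ j ∈ Finset.range k, (A * x j + X.A₀) * ∑ e ∈ Q.filter (fun e => e.1 ≤ j), V e
        = ∑ e ∈ Q, V e * S e := exchange_sum Q k (fun j => A * x j + X.A₀) V
    have step3 : ∀ e ∈ Q, -(gain e) + V e * S e ≤ θ e := by
      intro e he
      have heE : e ∈ X.E k := hQ he
      have hik : e.1 < k := X.E_lt k e heE
      exact perSource_net_le (x := x) hA X.A₀_nonneg hcg hℓ hik
        (fun j hj => hx1 j (hj.trans hk)) (fun j hij hj => hxmono e.1 j hij (hj.trans hk))
        (hxdiff e.1 hik.le) hp hb₁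
    calc B Q + X.A₀ * ∑ j ∈ Finset.range k, X.zvol k j Q
        = -(∑ e ∈ Q, gain e) + ∑ j ∈ Finset.range k, (A * x j + X.A₀) * X.zvol k j Q
            - (if e₀ ∈ Q then 0 else M) := step1
      _ ≤ -(∑ e ∈ Q, gain e) + ∑ j ∈ Finset.range k, (A * x j + X.A₀) * ∑ e ∈ Q.filter (fun e => e.1 ≤ j), V e
            - (if e₀ ∈ Q then 0 else M) := by linarith [Finset.sum_le_sum hz]
      _ = -(∑ e ∈ Q, gain e) + ∑ e ∈ Q, V e * S e - (if e₀ ∈ Q then 0 else M) := by rw [step2]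
      _ = ∑ e ∈ Q, (-(gain e) + V e * S e) - (if e₀ ∈ Q then 0 else M) := by
          rw [Finset.sum_add_distrib, Finset.sum_neg_distrib]
      _ ≤ ∑ e ∈ Q, θ e - (if e₀ ∈ Q then 0 else M) := by linarith [Finset.sum_le_sum step3]
  -- the surviving factor at scale j is at most e^{−κ x_j}, κ = c₁b₀²/8
  have hθ : ∀ e ∈ X.E k, Real.exp (θ e) ≤ Real.exp (-(c₁ * T.b₀ ^ 2 / 8 * x e.1)) := by
    intro e he
    have hik : e.1 < k := X.E_lt k e he
    have hxe : 1 ≤ x e.1 := hx1 e.1 (by omega)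
    have hx0 : 0 ≤ x e.1 := by linarith
    apply Real.exp_le_exp.mpr
    have h2 : (x e.1 ^ T.p₀) ^ 2 = x e.1 ^ (2 * T.p₀) := by
      rw [mul_comm, Real.rpow_mul hx0, Real.rpow_two]
    have h3 : x e.1 ≤ x e.1 ^ (2 * T.p₀) := by
      have := Real.rpow_le_rpow_of_exponent_le hxe hp1
      rwa [Real.rpow_one] at this
    have h4 : c₁ * T.b₀ ^ 2 / 8 * x e.1 ≤ c₁ * T.b₀ ^ 2 / 8 * (x e.1 ^ T.p₀) ^ 2 := by
      rw [h2]
      exact mul_le_mul_of_nonneg_left h3 hκ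
    show -(c₁ * (T.b₀ * x e.1 ^ T.p₀) ^ 2 / 8) ≤ -(c₁ * T.b₀ ^ 2 / 8 * x e.1)
    rw [mul_pow]
    linarith
  have hxj : ∀ j, j < k → 1 + ((k - j : ℕ) : ℝ) * ℓ ≤ x j := by
    intro j hj
    have := hxdiff j hj.le
    have := hx1 k hk
    linarith
  have hκℓ : X.σ + ℓ ≤ c₁ * T.b₀ ^ 2 / 8 * ℓ := by linarith
  have hfinal : ∑ e ∈ X.E k, Real.exp (θ e) ≤ 3 / ℓ * T.sites k := by
    calc ∑ e ∈ X.E k, Real.exp (θ e) ≤ ∑ e ∈ X.E k, Real.exp (-(c₁ * T.b₀ ^ 2 / 8 * x e.1)) :=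
          Finset.sum_le_sum hθ
      _ ≤ ∑ j ∈ Finset.range k,
            3 * Real.exp (X.σ * ((k - j : ℕ) : ℝ)) * T.sites k * Real.exp (-(c₁ * T.b₀ ^ 2 / 8 * x j)) :=
          sum_candidates_le X k (fun j => Real.exp (-(c₁ * T.b₀ ^ 2 / 8 * x j))) fun j => (Real.exp_pos _).le
      _ ≤ 3 * T.sites k / ℓ :=
          scaleEntropy_sum_le x k hℓ (T.sites_nonneg k) hκ hκℓ hxj
      _ = 3 / ℓ * T.sites k := by ring
  -- the pinned candidate's own surviving exponent is `−(c₁/8)·p(g_{e₀.1})²`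
  have hθe₀ : θ e₀ = -(c₁ / 8 * B10.pFun T.b₀ T.p₀ (T.g e₀.1) ^ 2) := by
    simp only [θ, pFun_eq, hxdef]
    ring
  have hpos : 0 ≤ Real.exp (θ e₀) + Real.exp (-M) := by positivity
  calc T.LF k U (fun h => -(T.mainT k h U) + T.Zterm k h - π h)
      ≤ ∑ Q ∈ (X.E k).powerset, Real.exp (B Q + X.A₀ * ∑ j ∈ Finset.range k, X.zvol k j Q) := hdom
    _ ≤ ∑ Q ∈ (X.E k).powerset, Real.exp (∑ e ∈ Q, θ e - (if e₀ ∈ Q then 0 else M)) :=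
        Finset.sum_le_sum hsummand
    _ ≤ (Real.exp (θ e₀) + Real.exp (-M)) * Real.exp (∑ e ∈ X.E k, Real.exp (θ e)) :=
        sum_powerset_exp_sum_penalty_le _ θ he₀ M
    _ ≤ (Real.exp (θ e₀) + Real.exp (-M)) * Real.exp (3 / ℓ * T.sites k) :=
        mul_le_mul_of_nonneg_left (Real.exp_le_exp.mpr hfinal) hpos
    _ = (Real.exp (-(c₁ / 8 * B10.pFun T.b₀ T.p₀ (T.g e₀.1) ^ 2)) + Real.exp (-M))
          * Real.exp (3 / ℓ * T.sites k) := by rw [hθe₀]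

/-- ★★ **The same on the printed flow** `g_j = g(Lʲε)^{1∕2}` (p. 256; `B10.gRun`), `ℓ = ½ log L`, `σ = 3 log L`: the progression
hypothesis is lit `B10LargeField.xlog_gRun` and the scale condition becomes `c₁b₀² ≥ 56`; twin of lit
✓`largeFieldControl_of_resummation_gRun` with one plaquette pinned — surviving factor `exp(−(c₁∕8)p(g_{e₀.1})²)` in front of
`exp((6∕log L)·|T₁^{(k)}|)`. [cite: Balaban1985UV3, (5) p.256, (7) p.257, (41) p.266, pp.273–274] -/
theorem largeField_pinned_of_resummation_gRun (X : HistModel T) {A c₁ gs cg ρ r₀ g L ε : ℝ}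
    (hSF : SmallFactorsAll X c₁ gs) (hZ : ZtermRate X A) (hV : ZvolCover X cg ρ r₀)
    (hA : 0 ≤ A) (hc₁ : 0 ≤ c₁) (hcg : 0 ≤ cg * ρ) (hr : 0 ≤ r₀) (hg0 : 0 < g) (hL : 1 < L) (hε : 0 < ε)
    (hrun : ∀ j, T.g j = B10.gRun g L ε j)
    (hg : ∀ j, j ≤ T.K → 0 < T.g j ∧ T.g j ≤ gs) (hgs : gs ≤ 1)
    (hσ : X.σ = 3 * Real.log L)
    (hp : r₀ * 3 + 2 ≤ 2 * T.p₀)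
    (hb₁ : 8 * ((A + X.A₀) * (cg * ρ) ^ 3 / (Real.log L / 2)) ≤ c₁ * T.b₀ ^ 2)
    (hb₂ : 56 ≤ c₁ * T.b₀ ^ 2)
    {k : ℕ} (hk : k ≤ T.K) (U : T.Cfg k) {e₀ : ℕ × X.α} (he₀ : e₀ ∈ X.E k) (M : ℝ)
    (π : T.Hist k → ℝ) (hπ0 : ∀ h, 0 ≤ π h) (hπM : ∀ h, e₀ ∉ X.disc k h → M ≤ π h) :
    T.LF k U (fun h => -(T.mainT k h U) + T.Zterm k h - π h)
      ≤ (Real.exp (-(c₁ / 8 * B10.pFun T.b₀ T.p₀ (T.g e₀.1) ^ 2)) + Real.exp (-M))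
          * Real.exp (3 / (Real.log L / 2) * T.sites k) := by
  have hlog : 0 < Real.log L := Real.log_pos hL
  have hℓ : 0 < Real.log L / 2 := by positivity
  refine largeField_pinned_of_resummation X (xK := xlog (T.g T.K)) hSF hZ hV hA hc₁ hcg hr hℓ hg hgs ?_ hp hb₁ ?_
    hk U he₀ M π hπ0 hπM
  · intro j hj
    rw [hrun j, hrun T.K]
    exact xlog_gRun g L ε hg0 (by linarith) hε hj
  · rw [hσ]
    nlinarith

end Main

/-! ## §3 The surviving factor is monotone down the scales -/

section Scales

variable {T : B10.TowerRun}

/-- ★ **A PIN AT AN EARLIER SCALE IS AT LEAST AS GOOD.**  On the window `0 < g_i ≤ g_j ≤ 1` (couplings increase along the run),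
`b₀ ≥ 0`, `p₀ ≥ 0`, `c ≥ 0`: `exp(−c·p(g_i)²) ≤ exp(−c·p(g_j)²)` — `p(g) = b₀(1 + log g⁻¹)^{p₀}` is antitone in `g`.  Used when the
event's plaquette is not in `Λ_j` but inside the collar of an earlier large field (the pinned candidate then sits at a scale
`i ≤ j`). [cite: Balaban1985UV3, (7) p.257, (39) p.266, (71) p.273] -/
theorem exp_neg_pFun_sq_mono {c b₀ p₀ gi gj : ℝ} (hc : 0 ≤ c) (hb : 0 ≤ b₀) (hp : 0 ≤ p₀)
    (hgi : 0 < gi) (hij : gi ≤ gj) (hgj : gj ≤ 1) :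
    Real.exp (-(c * B10.pFun b₀ p₀ gi ^ 2)) ≤ Real.exp (-(c * B10.pFun b₀ p₀ gj ^ 2)) := by
  apply Real.exp_le_exp.mpr
  have hxj : 1 ≤ xlog gj := one_le_xlog (hgi.trans_le hij) hgj
  have hxij : xlog gj ≤ xlog gi := by
    unfold xlog
    have : Real.log gj⁻¹ ≤ Real.log gi⁻¹ :=
      Real.log_le_log (inv_pos.mpr (hgi.trans_le hij)) (inv_anti₀ hgi hij)
    linarith
  have hpj : B10.pFun b₀ p₀ gj ≤ B10.pFun b₀ p₀ gi := by
    rw [pFun_eq, pFun_eq]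
    exact mul_le_mul_of_nonneg_left (Real.rpow_le_rpow (by linarith) hxij hp) hb
  have hpj0 : 0 ≤ B10.pFun b₀ p₀ gj := by
    rw [pFun_eq]
    exact mul_nonneg hb (Real.rpow_nonneg (by linarith) _)
  have hsq : B10.pFun b₀ p₀ gj ^ 2 ≤ B10.pFun b₀ p₀ gi ^ 2 := by
    exact pow_le_pow_left₀ hpj0 hpj 2
  nlinarith [mul_le_mul_of_nonneg_left hsq hc]

/-- ★ **THE PINNED BOUND WITH THE PIN MOVED TO THE EVENT'S SCALE**: under the hypotheses of `largeField_pinned_of_resummation`, if the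
pinned candidate sits at a scale `e₀.1 ≤ j ≤ K` and `b₀, p₀ ≥ 0`, the surviving factor may be quoted at scale `j`:
`LF k U (−mainT + Zterm − π) ≤ (exp(−(c₁∕8)p(g_j)²) + exp(−M)) · exp((3∕ℓ)|T₁^{(k)}|)`. [cite: Balaban1985UV3, (41) p.266, (71) p.273, (39) p.266] -/
theorem largeField_pinned_scale_mono (X : HistModel T) {A c₁ gs cg ρ r₀ ℓ xK : ℝ}
    (hSF : SmallFactorsAll X c₁ gs) (hZ : ZtermRate X A) (hV : ZvolCover X cg ρ r₀)
    (hA : 0 ≤ A) (hc₁ : 0 ≤ c₁) (hcg : 0 ≤ cg * ρ) (hr : 0 ≤ r₀) (hℓ : 0 < ℓ)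
    (hg : ∀ j, j ≤ T.K → 0 < T.g j ∧ T.g j ≤ gs) (hgs : gs ≤ 1)
    (hx : ∀ j, j ≤ T.K → xlog (T.g j) = xK + ((T.K - j : ℕ) : ℝ) * ℓ)
    (hp : r₀ * 3 + 2 ≤ 2 * T.p₀)
    (hb₁ : 8 * ((A + X.A₀) * (cg * ρ) ^ 3 / ℓ) ≤ c₁ * T.b₀ ^ 2)
    (hb₂ : 8 * (X.σ + ℓ) ≤ c₁ * T.b₀ ^ 2 * ℓ)
    (hb₀ : 0 ≤ T.b₀) (hp₀ : 0 ≤ T.p₀)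
    {k : ℕ} (hk : k ≤ T.K) (U : T.Cfg k) {e₀ : ℕ × X.α} (he₀ : e₀ ∈ X.E k) {j : ℕ} (hij : e₀.1 ≤ j) (hj : j ≤ T.K)
    (M : ℝ) (π : T.Hist k → ℝ) (hπ0 : ∀ h, 0 ≤ π h) (hπM : ∀ h, e₀ ∉ X.disc k h → M ≤ π h) :
    T.LF k U (fun h => -(T.mainT k h U) + T.Zterm k h - π h)
      ≤ (Real.exp (-(c₁ / 8 * B10.pFun T.b₀ T.p₀ (T.g j) ^ 2)) + Real.exp (-M))
          * Real.exp (3 / ℓ * T.sites k) := by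
  have h1 := largeField_pinned_of_resummation X hSF hZ hV hA hc₁ hcg hr hℓ hg hgs hx hp hb₁ hb₂ hk U he₀ M π hπ0 hπM
  -- `g_{e₀.1} ≤ g_j` along the progression (x antitone in the scale index ⇒ g monotone)
  have hgi := hg e₀.1 (hij.trans hj)
  have hgj := hg j hj
  have hxle : xlog (T.g j) ≤ xlog (T.g e₀.1) := by
    rw [hx e₀.1 (hij.trans hj), hx j hj]
    have : ((T.K - j : ℕ) : ℝ) ≤ ((T.K - e₀.1 : ℕ) : ℝ) := by exact_mod_cast Nat.sub_le_sub_left hij _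
    nlinarith
  have hgle : T.g e₀.1 ≤ T.g j := by
    -- xlog is strictly antitone on (0, ∞): xlog a ≤ xlog b ⇒ b ≤ a
    refine le_of_not_gt fun hlt => ?_
    have : xlog (T.g e₀.1) < xlog (T.g j) := by
      unfold xlog
      have := Real.log_lt_log (inv_pos.mpr hgi.1) (inv_strictAnti₀ hgj.1 hlt)
      linarith
    linarith
  have hmono := exp_neg_pFun_sq_mono (c := c₁ / 8) (by positivity) hb₀ hp₀ hgi.1 hgle (hgj.2.trans hgs)
  have hfac : Real.exp (-(c₁ / 8 * B10.pFun T.b₀ T.p₀ (T.g e₀.1) ^ 2)) + Real.exp (-M)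
      ≤ Real.exp (-(c₁ / 8 * B10.pFun T.b₀ T.p₀ (T.g j) ^ 2)) + Real.exp (-M) := by linarith
  exact h1.trans (mul_le_mul_of_nonneg_right hfac (Real.exp_pos _).le)

end Scales

end Summit.QuantumFields.YangMills.Theorems.UV3PinnedLargeFieldResummation

end
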